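import Summits.Ventures.WeilGRH.TwistedWindowMeasureGrowth
import Summits.Ventures.WeilGRH.FlatWindowConstantsExact
import Summits.RiemannHypothesis.RiemannHypothesis.Theorems.HandoffCramerBump
import Summits.RiemannHypothesis.RiemannHypothesis.Theorems.SoloInformedQuasiWeilCriterion
import HarnessLib

/-!
# rh-explicit (venture WeilGRH): THE WINDOW BUDGET MADE ELEMENTARY, AND THE GOLDSTON–GONEK ASYMPTOTICS —
  `2a·m ≤ P + log(1+|τ|) + C + 5/a + 8a·e^a` for all windows forces `m ≤ (½+o(1)) log τ/log log τ`;
  for `L(s, χ)` under GRH: `ord_{s=½+iτ}L(s,χ) ≤ (½+o(1)) log τ/log log τ`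

Cell `rh-explicit`, WEIL TRACK (structure seat weil-3, gen10).  Depends only on long-built modules (gen9's
`FlatWindowAtoms`/`TwistedWindowMeasureGrowth`, the constants of `FlatWindowConstantsExact`, the digamma majorant of
`HandoffCramerBump`, the crude prime bound of `SoloInformedQuasiWeilCriterion`).  The `ζ` application is
`ZetaMultiplicityBound.lean` (it needs the pole term of `ZetaWindowAtoms.lean`).

* `flatBudget_le`: `2Σ_{log n<2a}Λ(n)n^{-1/2}(1 − log n/(2a)) ≤ 8a·e^a`;
* `archConstants_le_log` (`κ = 0`) and `archConstants_le_log_char` (any `χ`):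
  `−K_κ + [Re ψ(¼+iτ/2) − Re ψ(¼)] ≤ log(1+|τ|) + 3 − log π + π·κ`;
* **`goldstonGonek_of_window_budget`** (pure real analysis): if `m ≥ 0` satisfies, for every window `a > 0` and
  every `τ`, `2a·m(τ) ≤ P(a,τ) + log(1+|τ|) + C + 5/a + 8a·e^a` with `P(a,τ) ≤ 8` whenever `1 ≤ a`, `1 ≤ τ`,
  `e^a ≤ τ`, then for every `ε > 0`, eventually `m(τ) ≤ (½ + ε) log τ/log log τ` (window `a = log L − 2 log log L`,
  `L = log τ`);
* **`two_mul_mul_charZeroOrder_le_explicit`**: GRH(χ), χ primitive mod `q ≠ 1` ⟹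
  `2a·ord_{s=½+iτ}L(s,χ) ≤ log q + log(1+|τ|) + 3 − log π + π + 5/a + 8a·e^a` for every `a > 0`, `τ`;
* **`charZeroOrder_le_goldstonGonek_of_grh`**: GRH(χ) ⟹ ∀ ε > 0, ∀ᶠ τ → ∞,
  `ord_{s=½+iτ} L(s,χ) ≤ (½ + ε) log τ/log log τ` — the Goldston–Gonek shape and constant for Dirichlet
  `L`-functions, from Weil positivity one window at a time.

No definitions, no named facts; GRH only where named.

## References

* D. A. Goldston, S. M. Gonek, *A note on S(t) and the zeros of the Riemann zeta-function*, Bull. London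
  Math. Soc. 39 (2007) 482–486. [GoldstonGonek2007]
-/

set_option autoImplicit false

noncomputable section

open Complex Filter Set MeasureTheory
open scoped Real Topology ComplexConjugate ArithmeticFunction.vonMangoldt

namespace Summit.Ventures.WeilGRH

open Literature.NumberTheory.LFunctions
open Literature.Analysis.SpecialFunctions (reDigammaQuarter)
open Summit.RiemannHypothesis.RiemannHypothesis.Theorems.WeilFormatC

variable {q : ℕ} {a : ℝ}

/-! ## The prime budget and the archimedean constants, elementarily -/

/-- The prime budget of a window is at most `8a·e^a`: `2Σ_{log n<2a} Λ(n)n^{-1/2}(1 − log n/(2a)) ≤ 8a·e^a`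
(weights in `[0,1]`, `Λ(n) ≤ 2a`, `Σ_{n≤e^{2a}} n^{-1/2} ≤ 2e^a` — `sum_vonMangoldt_div_sqrt_le`). -/
theorem flatBudget_le (ha : 0 < a) :
    2 * (∑ n ∈ weilPrimeIndex a, (Λ n : ℝ) / Real.sqrt n * (1 - Real.log n / (2 * a))) ≤
      8 * a * Real.exp a := by
  have h1 : ∑ n ∈ weilPrimeIndex a, (Λ n : ℝ) / Real.sqrt n * (1 - Real.log n / (2 * a)) ≤
      ∑ n ∈ weilPrimeIndex a, (Λ n : ℝ) / Real.sqrt n := by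
    refine Finset.sum_le_sum fun n hn ↦ ?_
    have hΛ : 0 ≤ (Λ n : ℝ) / Real.sqrt n := div_nonneg ArithmeticFunction.vonMangoldt_nonneg (Real.sqrt_nonneg _)
    have hw : 1 - Real.log n / (2 * a) ≤ 1 := by
      have : 0 ≤ Real.log n / (2 * a) := div_nonneg (Real.log_natCast_nonneg n) (by linarith)
      linarith
    calc (Λ n : ℝ) / Real.sqrt n * (1 - Real.log n / (2 * a)) ≤ (Λ n : ℝ) / Real.sqrt n * 1 :=
          mul_le_mul_of_nonneg_left hw hΛ
      _ = _ := mul_one _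
  have h2 : ∑ n ∈ weilPrimeIndex a, (Λ n : ℝ) / Real.sqrt n ≤
      ∑ n ∈ Finset.range (⌊Real.exp (2 * a)⌋₊ + 1), (Λ n : ℝ) / Real.sqrt n := by
    refine Finset.sum_le_sum_of_subset_of_nonneg (fun n hn ↦ ?_) fun n _ _ ↦
      div_nonneg ArithmeticFunction.vonMangoldt_nonneg (Real.sqrt_nonneg _)
    unfold weilPrimeIndex at hn
    exact (Finset.mem_filter.1 hn).1
  have h3 := Summit.RiemannHypothesis.RiemannHypothesis.Theorems.sum_vonMangoldt_div_sqrt_le ha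
  linarith

/-- The archimedean constants made elementary: `−K₀ + [Re ψ(¼+iτ/2) − Re ψ(¼)] ≤ log(1+|τ|) + 3 − log π`
(`K₀ = log 8π + γ + π/2`, `Re ψ(¼) = −γ − π/2 − 3 log 2`, `Re ψ(¼+iτ/2) ≤ log(1+|τ|) + 3`). -/
theorem archConstants_le_log (τ : ℝ) :
    -(Real.log (4 * π) + Real.eulerMascheroniConstant +
          2 * ∫ t in Ioi (0 : ℝ), (Real.exp (t / 2) - 1) / (2 * Real.sinh t)) +
        (reDigammaQuarter τ - reDigammaQuarter 0) ≤ Real.log (1 + |τ|) + 3 - Real.log π := by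
  have hK : Real.log (4 * π) + Real.eulerMascheroniConstant +
      2 * ∫ t in Ioi (0 : ℝ), (Real.exp (t / 2) - 1) / (2 * Real.sinh t) =
      Real.log (8 * π) + Real.eulerMascheroniConstant + π / 2 := by
    rw [← flatWindow_const_zero_eq]
    simp_rw [weilKillingDensityPar_zero_eq]
  have hψ := reDigammaQuarter_zero_eq
  have hτ := Summit.RiemannHypothesis.RiemannHypothesis.Theorems.Handoff.reDigammaQuarter_le_log_add_three τ
  have h8 : Real.log (8 * π) = 3 * Real.log 2 + Real.log π := by
    rw [Real.log_mul (by norm_num) Real.pi_ne_zero, show (8 : ℝ) = 2 ^ 3 by norm_num, Real.log_pow]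
    push_cast
    ring
  rw [hK, hψ, h8]
  linarith

/-- `−K_κ + [Re ψ(¼+iτ/2) − Re ψ(¼)] ≤ log(1+|τ|) + 3 − log π + π·κ` for the parity `κ ∈ {0,1}` of any `χ`
(`K_κ = log 8π + γ + (π/2)(1 − 2κ)`). -/
theorem archConstants_le_log_char (χ : DirichletCharacter ℂ q) (τ : ℝ) :
    -(Real.log (4 * π) + Real.eulerMascheroniConstant +
          2 * ∫ t in Ioi (0 : ℝ), weilKillingDensityPar (charParity χ) t) +
        (reDigammaQuarter τ - reDigammaQuarter 0) ≤
      Real.log (1 + |τ|) + 3 - Real.log π + π * (charParity χ : ℝ) := by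
  rw [flatWindow_const_eq χ]
  have hψ := reDigammaQuarter_zero_eq
  have hτ := Summit.RiemannHypothesis.RiemannHypothesis.Theorems.Handoff.reDigammaQuarter_le_log_add_three τ
  have h8 : Real.log (8 * π) = 3 * Real.log 2 + Real.log π := by
    rw [Real.log_mul (by norm_num) Real.pi_ne_zero, show (8 : ℝ) = 2 ^ 3 by norm_num, Real.log_pow]
    push_cast
    ring
  rw [hψ, h8]
  nlinarith [Real.pi_pos, (Nat.cast_nonneg (charParity χ) : (0 : ℝ) ≤ charParity χ)]

/-! ## From the window budget to Goldston–Gonek: pure real analysis -/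

/-- The auxiliary ratio `(8L + C'u + 2(1+2ε)L·log u)/(L·u)`, `L = log τ`, `u = log log τ`, tends to `0`. -/
private theorem tendsto_gg_aux (C' ε : ℝ) :
    Tendsto (fun τ : ℝ ↦ (8 * Real.log τ + C' * Real.log (Real.log τ) +
        2 * (1 + 2 * ε) * Real.log τ * Real.log (Real.log (Real.log τ))) /
        (Real.log τ * Real.log (Real.log τ))) atTop (𝓝 0) := by
  have TL : Tendsto (fun τ : ℝ ↦ Real.log τ) atTop atTop := Real.tendsto_log_atTop
  have Tu : Tendsto (fun τ : ℝ ↦ Real.log (Real.log τ)) atTop atTop := Real.tendsto_log_atTop.comp TL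
  have T1 : Tendsto (fun τ : ℝ ↦ 8 / Real.log (Real.log τ)) atTop (𝓝 0) := tendsto_const_nhds.div_atTop Tu
  have T2 : Tendsto (fun τ : ℝ ↦ C' / Real.log τ) atTop (𝓝 0) := tendsto_const_nhds.div_atTop TL
  have T3 : Tendsto (fun τ : ℝ ↦ Real.log (Real.log (Real.log τ)) / Real.log (Real.log τ)) atTop (𝓝 0) :=
    (Real.isLittleO_log_id_atTop.tendsto_div_nhds_zero).comp Tu
  have T := T1.add (T2.add (T3.const_mul (2 * (1 + 2 * ε))))
  simp only [add_zero, mul_zero] at T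
  refine T.congr' ?_
  filter_upwards [TL.eventually_gt_atTop 0, Tu.eventually_gt_atTop 0] with τ hL hu
  field_simp
  ring

/-- **FROM THE WINDOW BUDGET TO GOLDSTON–GONEK** (pure real analysis).  Let `m : ℝ → ℝ` be non-negative and
suppose that for every window `a > 0` and every `τ`,
`2a·m(τ) ≤ P(a,τ) + log(1+|τ|) + C + 5/a + 8a·e^a`, where the «pole» `P(a,τ) ≤ 8` as soon as `1 ≤ a`,
`1 ≤ τ` and `e^a ≤ τ`.  Then for every `ε > 0`, for all large `τ`: `m(τ) ≤ (½ + ε)·log τ/log log τ`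
(window `a = log L − 2 log log L`, `L = log τ`: `8a·e^a ≤ 8L/log L` is subdominant and `2a ~ 2 log log τ`). -/
theorem goldstonGonek_of_window_budget {m : ℝ → ℝ} {C : ℝ} {P : ℝ → ℝ → ℝ} (hm : ∀ τ, 0 ≤ m τ)
    (hP : ∀ a τ, 1 ≤ a → 1 ≤ τ → Real.exp a ≤ τ → P a τ ≤ 8)
    (h : ∀ a τ, 0 < a → 2 * a * m τ ≤ P a τ + Real.log (1 + |τ|) + C + 5 / a + 8 * a * Real.exp a)
    {ε : ℝ} (hε : 0 < ε) :
    ∀ᶠ τ : ℝ in atTop, m τ ≤ (1 / 2 + ε) * Real.log τ / Real.log (Real.log τ) := by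
  have TL : Tendsto (fun τ : ℝ ↦ Real.log τ) atTop atTop := Real.tendsto_log_atTop
  have Tu : Tendsto (fun τ : ℝ ↦ Real.log (Real.log τ)) atTop atTop := Real.tendsto_log_atTop.comp TL
  have T3 : Tendsto (fun τ : ℝ ↦ Real.log (Real.log (Real.log τ)) / Real.log (Real.log τ)) atTop (𝓝 0) :=
    (Real.isLittleO_log_id_atTop.tendsto_div_nhds_zero).comp Tu
  have hε2 : (0 : ℝ) < 2 * ε := by positivity
  filter_upwards [eventually_ge_atTop (1 : ℝ), Tu.eventually_ge_atTop 4,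
    (tendsto_order.1 T3).2 (1 / 4) (by norm_num), (tendsto_order.1 (tendsto_gg_aux (C + 14) ε)).2 (2 * ε) hε2]
    with τ hτ1 hu4 hlu hg
  set L : ℝ := Real.log τ with hL
  set u : ℝ := Real.log L with hu
  have hm0 := hm τ
  have hL0' : 0 ≤ L := Real.log_nonneg hτ1
  have hL0 : 0 < L := by
    rcases hL0'.eq_or_lt with h0 | h0
    · exfalso
      have : u = 0 := by rw [hu, ← h0, Real.log_zero]
      linarith
    · exact h0
  have hu0 : 0 < u := by linarith
  have hlogu0 : 0 ≤ Real.log u := Real.log_nonneg (by linarith)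
  have hlogu : Real.log u ≤ u / 4 := by
    have h' := hlu.le
    rwa [div_le_iff₀ hu0, show (1:ℝ) / 4 * u = u / 4 by ring] at h'
  set a : ℝ := u - 2 * Real.log u with ha
  have hau : a ≤ u := by linarith
  have ha1 : 1 ≤ a := by linarith
  have ha0 : 0 < a := by linarith
  have hexpu : Real.exp u = L := by rw [hu, Real.exp_log hL0]
  have hexp2 : Real.exp (2 * Real.log u) = u ^ 2 := by
    rw [show 2 * Real.log u = Real.log u + Real.log u by ring, Real.exp_add, Real.exp_log hu0, sq]
  have hexp : Real.exp a = L / u ^ 2 := by rw [ha, Real.exp_sub, hexpu, hexp2]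
  have hea_le : Real.exp a ≤ L := by
    rw [hexp, div_le_iff₀ (by positivity)]
    have : 1 ≤ u ^ 2 := by nlinarith
    nlinarith
  have hLτ : L ≤ τ := by
    have := Real.log_le_sub_one_of_pos (by linarith : (0 : ℝ) < τ)
    rw [hL]; linarith
  have h0 := h a τ ha0
  have hP8 := hP a τ ha1 hτ1 (hea_le.trans hLτ)
  have hlog : Real.log (1 + |τ|) ≤ L + 1 := by
    rw [abs_of_pos (by linarith)]
    have he : (2 : ℝ) ≤ Real.exp 1 := by
      have := Real.add_one_le_exp (1 : ℝ); linarith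
    calc Real.log (1 + τ) ≤ Real.log (Real.exp 1 * τ) :=
          Real.log_le_log (by linarith) (by nlinarith)
      _ = L + 1 := by rw [Real.log_mul (Real.exp_pos 1).ne' (by linarith), Real.log_exp, hL]; ring
  have h5 : 5 / a ≤ 5 := by
    rw [div_le_iff₀ ha0]; linarith
  have h8 : 8 * a * Real.exp a ≤ 8 * L / u := by
    rw [hexp, le_div_iff₀ hu0]
    have e : 8 * a * (L / u ^ 2) * u = 8 * L * (a / u) := by field_simp
    rw [e]
    exact mul_le_of_le_one_right (by positivity) ((div_le_one hu0).2 hau)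
  have hR : 2 * a * m τ ≤ L + 8 * L / u + (C + 14) := by linarith
  have hkey : 8 * L + (C + 14) * u + 2 * (1 + 2 * ε) * L * Real.log u < 2 * ε * (L * u) := by
    have h' := hg
    rw [div_lt_iff₀ (by positivity)] at h'
    linarith
  rw [le_div_iff₀ hu0]
  have hm_le : m τ ≤ (L + 8 * L / u + (C + 14)) / (2 * a) := by
    rw [le_div_iff₀ (by positivity)]; linarith
  have e1 : (L + 8 * L / u + (C + 14)) * u = L * u + 8 * L + (C + 14) * u := by field_simp
  have e2 : (1 / 2 + ε) * L * (2 * a) = L * u + 2 * ε * (L * u) - 2 * (1 + 2 * ε) * L * Real.log u := by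
    rw [ha]; ring
  calc m τ * u ≤ (L + 8 * L / u + (C + 14)) / (2 * a) * u := mul_le_mul_of_nonneg_right hm_le hu0.le
    _ = (L * u + 8 * L + (C + 14) * u) / (2 * a) := by rw [div_mul_eq_mul_div, e1]
    _ ≤ (1 / 2 + ε) * L := by
        rw [div_le_iff₀ (by positivity), e2]
        linarith

/-! ## Dirichlet `L`-functions under GRH -/

variable [NeZero q] {χ : DirichletCharacter ℂ q}

/-- **GRH ⟹ AN ELEMENTARY EXPLICIT MULTIPLICITY BOUND FOR `L(s, χ)`** (`χ` primitive mod `q ≠ 1`): for every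
`a > 0` and `τ`, `2a·ord_{s=½+iτ} L(s,χ) ≤ log q + (log(1+|τ|) + 3 − log π + π) + 5/a + 8a·e^a`
(gen9's `two_mul_mul_zeroOrder_le_of_grh` + `flatBudget_le` + `archConstants_le_log_char`, `κ ≤ 1`). -/
theorem two_mul_mul_charZeroOrder_le_explicit (hq : q ≠ 1) (hprim : χ.IsPrimitive) (hGRH : χ.RiemannHypothesis)
    (ha : 0 < a) (τ : ℝ) :
    2 * a * (DirichletDisc.zeroOrder χ (1 / 2 + τ * I) : ℝ) ≤
      Real.log q + (Real.log (1 + |τ|) + 3 - Real.log π + π) + 5 / a + 8 * a * Real.exp a := by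
  have h := two_mul_mul_zeroOrder_le_of_grh hq hprim hGRH ha τ
  have h1 := flatBudget_le ha
  have h2 := archConstants_le_log_char χ τ
  have hκ : (charParity χ : ℝ) ≤ 1 := by exact_mod_cast charParity_le_one χ
  nlinarith [Real.pi_pos]

/-- **GRH ⟹ THE GOLDSTON–GONEK BOUND FOR `L(s, χ)`** (`χ` primitive mod `q ≠ 1`, `q` fixed): for every `ε > 0`,
for all large `τ`, `ord_{s=½+iτ} L(s,χ) ≤ (½ + ε)·log τ/log log τ`. -/
theorem charZeroOrder_le_goldstonGonek_of_grh (hq : q ≠ 1) (hprim : χ.IsPrimitive) (hGRH : χ.RiemannHypothesis)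
    {ε : ℝ} (hε : 0 < ε) :
    ∀ᶠ τ : ℝ in atTop, (DirichletDisc.zeroOrder χ (1 / 2 + τ * I) : ℝ) ≤
      (1 / 2 + ε) * Real.log τ / Real.log (Real.log τ) :=
  goldstonGonek_of_window_budget (m := fun τ ↦ (DirichletDisc.zeroOrder χ (1 / 2 + τ * I) : ℝ))
    (C := Real.log q + 3 - Real.log π + π) (P := fun _ _ ↦ 0) (fun _ ↦ by positivity)
    (fun _ _ _ _ _ ↦ by norm_num)
    (fun a τ ha ↦ by have := two_mul_mul_charZeroOrder_le_explicit hq hprim hGRH ha τ; linarith) hε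

end Summit.Ventures.WeilGRH
-- Build note (weil-3 gen13, 2026-08-24): byte-identical re-land under lead ruling R14-3 (APPEND REMEDY) to trigger the hub build; p371372 accepted 2026-08-23T20:04Z.
end
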